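import Mathlib
import Literature.NumberTheory.Sieve.ParityBatemanHornProofs

/-!
# Ladders toward Landau's problem: the summit is the endpoint of every family

Solo-blind programme on `Parity/BatemanHorn`, §9 of the write-up ("Ladders and ceilings").
Every one-parameter family of PROVED theorems approaching Landau's conjecture
(`{n : n² + 1 prime}` infinite, the tree's `Literature.NumberTheory.Sieve.LandauConjecture`, a
consequence of `HardyLittlewoodConjE` and hence of `BatemanHornConjecture`) is indexed by a real
or integer parameter measuring the length of an auxiliary variable; this file types four of the
families as parametrised sets and proves, for each, (i) monotonicity in the parameter and (ii) that
the infinitude of the set at the parameter value where the auxiliary variable disappears is EXACTLY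
Landau's conjecture.  Records and printed ceilings (for orientation; none of them is used or
asserted here):

* `gpfSet α` — the `n` such that `n² + 1` has a prime factor `> n^α`.  Records for its infinitude:
  `α = 1.1` (Hooley 1967), `1.2024` (Deshouillers–Iwaniec 1982), `1.2182` (de la Bretèche–Drappeau
  2019), `1.279` (Merikoski, arXiv:1908.08816, Thm 1), `1.312` unconditionally
  (Grimmelt–Merikoski, arXiv:2505.00493, Thm 1.1).  Printed ceiling: Type II information only for
  moduli `P < x^{153/128}`, programme horizon `α < 3/2` (arXiv:1908.08816, pp. 4, 17).
  Endpoint: `(gpfSet 2).Infinite ↔ LandauConjecture` (`gpfSet_two_infinite_iff`).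
* `almostPrimeSet r` — the `n ≥ 1` with `Ω(n² + 1) ≤ r`.  Record `r = 2` (Iwaniec 1978).
  Endpoint: `(almostPrimeSet 1).Infinite ↔ LandauConjecture` (`almostPrimeSet_one_infinite_iff`).
* `twoSquaresPrimeSet θ` — primes `p = a² + b²` with `1 ≤ b ≤ p^θ`.  Record `θ = 0.119`
  (Harman–Lewis 2001, Mathematika 48, Thm 1); `b ≪ log p` under GRH for Hecke `L`-functions
  (Ankeny, Kubilius).  Endpoint: `(twoSquaresPrimeSet 0).Infinite ↔ LandauConjecture`
  (`twoSquaresPrimeSet_zero_infinite_iff`).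
* `squarePartPrimeSet θ` — primes `p = a·d² + 1` with `d ≥ 1` and cofactor `a ≤ p^{1−θ}`.
  Records: `θ = 1/2 − ε` (Matomäki 2009, Acta Arith. 137, Thm 1, `d` prime), `1/2 + 1/2000`
  (Merikoski), `1/2 + 1/700` (arXiv:2505.23779, Thm 1.1); "the exponent `1/2` is the limit of the
  current method as it is in the Bombieri–Vinogradov theorem" (Matomäki, p. 133).
  Endpoint: `(squarePartPrimeSet 1).Infinite ↔ LandauConjecture`
  (`squarePartPrimeSet_one_infinite_iff`).

In each family the engine of the records is the auxiliary variable (the cofactor `(n²+1)/p`, the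
number of prime factors, the coordinate `b`, the cofactor `a`), and the endpoint is the parameter
value at which it has length `x^{o(1)}`; the equivalences below are elementary and only pin the
summit to the families formally.
-/

namespace Summit.Parity.BatemanHorn.Theorems

open ArithmeticFunction Literature.NumberTheory.Sieve
open scoped ArithmeticFunction.Omega

/-! ### The four families -/

/-- Greatest-prime-factor ladder: the `n` such that `n² + 1` has a prime factor `p > n^α`. -/
def gpfSet (α : ℝ) : Set ℕ :=
  {n : ℕ | ∃ p : ℕ, p.Prime ∧ p ∣ n ^ 2 + 1 ∧ (n : ℝ) ^ α < p}

/-- Almost-prime ladder: the `n ≥ 1` with `Ω(n² + 1) ≤ r`. -/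
def almostPrimeSet (r : ℕ) : Set ℕ :=
  {n : ℕ | 1 ≤ n ∧ Ω (n ^ 2 + 1) ≤ r}

/-- Two-squares ladder: the primes `p = a² + b²` with `1 ≤ b ≤ p^θ`. -/
def twoSquaresPrimeSet (θ : ℝ) : Set ℕ :=
  {p : ℕ | p.Prime ∧ ∃ a b : ℕ, 1 ≤ b ∧ p = a ^ 2 + b ^ 2 ∧ (b : ℝ) ≤ (p : ℝ) ^ θ}

/-- Square-part ladder: the primes `p = a·d² + 1`, `d ≥ 1`, with cofactor `a ≤ p^{1-θ}`
(up to the normalisation of the exponent: `d² ∣ p − 1` with `d² ≥ p^θ`). -/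
def squarePartPrimeSet (θ : ℝ) : Set ℕ :=
  {p : ℕ | p.Prime ∧ ∃ a d : ℕ, 1 ≤ d ∧ p = a * d ^ 2 + 1 ∧ (a : ℝ) ≤ (p : ℝ) ^ (1 - θ)}

/-- The primes of the form `n² + 1`. -/
def sqAddOnePrimeSet : Set ℕ :=
  {p : ℕ | p.Prime ∧ ∃ n : ℕ, p = n ^ 2 + 1}

/-! ### Monotonicity in the parameter -/

/-- The gpf ladder is monotone: a larger exponent gives a smaller set. -/
theorem gpfSet_antitone {α α' : ℝ} (h : α' ≤ α) : gpfSet α ⊆ gpfSet α' := by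
  intro n hn
  obtain ⟨p, hp, hpd, hlt⟩ := hn
  refine ⟨p, hp, hpd, ?_⟩
  rcases Nat.eq_zero_or_pos n with rfl | hnpos
  · have h2 : (2 : ℝ) ≤ p := by exact_mod_cast hp.two_le
    have : (0 : ℝ) ^ α' ≤ 1 := Real.zero_rpow_le_one α'
    push_cast
    linarith
  · have h1 : (1 : ℝ) ≤ n := by exact_mod_cast hnpos
    exact lt_of_le_of_lt (Real.rpow_le_rpow_of_exponent_le h1 h) hlt

/-- The almost-prime ladder is monotone. -/
theorem almostPrimeSet_monotone {r r' : ℕ} (h : r ≤ r') : almostPrimeSet r ⊆ almostPrimeSet r' :=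
  fun _ hn => ⟨hn.1, hn.2.trans h⟩

/-- The two-squares ladder is monotone. -/
theorem twoSquaresPrimeSet_monotone {θ θ' : ℝ} (h : θ ≤ θ') :
    twoSquaresPrimeSet θ ⊆ twoSquaresPrimeSet θ' := by
  intro p hp
  obtain ⟨hpr, a, b, hb, hpe, hle⟩ := hp
  have h1 : (1 : ℝ) ≤ p := by exact_mod_cast hpr.one_lt.le
  exact ⟨hpr, a, b, hb, hpe, hle.trans (Real.rpow_le_rpow_of_exponent_le h1 h)⟩

/-- The square-part ladder is monotone: a larger exponent gives a smaller set. -/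
theorem squarePartPrimeSet_antitone {θ θ' : ℝ} (h : θ' ≤ θ) :
    squarePartPrimeSet θ ⊆ squarePartPrimeSet θ' := by
  intro p hp
  obtain ⟨hpr, a, d, hd, hpe, hle⟩ := hp
  have h1 : (1 : ℝ) ≤ p := by exact_mod_cast hpr.one_lt.le
  exact ⟨hpr, a, d, hd, hpe, hle.trans (Real.rpow_le_rpow_of_exponent_le h1 (by linarith))⟩

/-! ### Transporting infinitude along `n ↦ n² + 1` -/

/-- `n ↦ n² + 1` is injective on `ℕ`. -/
theorem sq_add_one_injective : Function.Injective fun n : ℕ => n ^ 2 + 1 := by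
  intro m n h
  have : m ^ 2 = n ^ 2 := by simpa using h
  exact Nat.pow_left_injective two_ne_zero this

/-- The set of primes of the form `n² + 1` is infinite iff Landau's conjecture holds. -/
theorem sqAddOnePrimeSet_infinite_iff : sqAddOnePrimeSet.Infinite ↔ LandauConjecture := by
  unfold LandauConjecture sqAddOnePrimeSet
  constructor
  · intro h
    by_contra hfin
    rw [Set.not_infinite] at hfin
    apply h
    refine (hfin.image fun n : ℕ => n ^ 2 + 1).subset ?_
    rintro p ⟨hp, n, rfl⟩
    exact ⟨n, hp, rfl⟩
  · intro h
    refine (h.image sq_add_one_injective.injOn).mono ?_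
    rintro p ⟨n, hn, rfl⟩
    exact ⟨hn, n, rfl⟩

/-! ### Endpoints: each family at its summit value is exactly Landau's conjecture -/

/-- At `α = 2` the gpf set is the set of `n` with `n² + 1` prime: a prime factor `p > n²` of
`n² + 1` is `n² + 1` itself. -/
theorem gpfSet_two : gpfSet 2 = {n : ℕ | (n ^ 2 + 1).Prime} := by
  ext n
  simp only [gpfSet, Set.mem_setOf_eq, Real.rpow_two]
  constructor
  · rintro ⟨p, hp, hpd, hlt⟩
    have hle : p ≤ n ^ 2 + 1 := Nat.le_of_dvd (Nat.succ_pos _) hpd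
    have hgt : n ^ 2 < p := by exact_mod_cast hlt
    have : p = n ^ 2 + 1 := by omega
    rwa [this] at hp
  · intro hp
    refine ⟨n ^ 2 + 1, hp, dvd_rfl, ?_⟩
    push_cast
    linarith

/-- `(gpfSet 2).Infinite ↔ LandauConjecture`. -/
theorem gpfSet_two_infinite_iff : (gpfSet 2).Infinite ↔ LandauConjecture := by
  rw [gpfSet_two]; rfl

/-- For `m ≥ 2`, `Ω m ≠ 0`. -/
theorem cardFactors_ne_zero_of_two_le {m : ℕ} (hm : 2 ≤ m) : Ω m ≠ 0 := by
  rw [cardFactors_apply]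
  have hmem : m.minFac ∈ m.primeFactorsList :=
    (Nat.mem_primeFactorsList (by omega)).2 ⟨Nat.minFac_prime (by omega), Nat.minFac_dvd m⟩
  exact Nat.pos_iff_ne_zero.1 (List.length_pos_of_mem hmem)

/-- At `r = 1` the almost-prime set is the set of `n ≥ 1` with `n² + 1` prime. -/
theorem almostPrimeSet_one : almostPrimeSet 1 = {n : ℕ | (n ^ 2 + 1).Prime} \ {0} := by
  ext n
  simp only [almostPrimeSet, Set.mem_setOf_eq, Set.mem_sdiff, Set.mem_singleton_iff]
  constructor
  · rintro ⟨hn, hΩ⟩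
    have h2 : 2 ≤ n ^ 2 + 1 := by nlinarith
    have hne := cardFactors_ne_zero_of_two_le h2
    have hΩ1 : Ω (n ^ 2 + 1) = 1 := by omega
    exact ⟨cardFactors_eq_one_iff_prime.1 hΩ1, by omega⟩
  · rintro ⟨hp, hn⟩
    exact ⟨by omega, (cardFactors_eq_one_iff_prime.2 hp).le⟩

/-- `(almostPrimeSet 1).Infinite ↔ LandauConjecture`. -/
theorem almostPrimeSet_one_infinite_iff : (almostPrimeSet 1).Infinite ↔ LandauConjecture := by
  rw [almostPrimeSet_one]
  unfold LandauConjecture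
  constructor
  · exact fun h => h.mono Set.sdiff_subset
  · exact fun h => h.sdiff (Set.finite_singleton 0)

/-- At `θ = 0` the two-squares set is the set of primes `n² + 1`: `1 ≤ b ≤ p⁰` forces `b = 1`. -/
theorem twoSquaresPrimeSet_zero : twoSquaresPrimeSet 0 = sqAddOnePrimeSet := by
  ext p
  simp only [twoSquaresPrimeSet, sqAddOnePrimeSet, Set.mem_setOf_eq, Real.rpow_zero]
  constructor
  · rintro ⟨hp, a, b, hb, hpe, hle⟩
    have hb1 : b ≤ 1 := by exact_mod_cast hle
    have : b = 1 := le_antisymm hb1 hb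
    subst this
    exact ⟨hp, a, by simpa using hpe⟩
  · rintro ⟨hp, n, hpe⟩
    exact ⟨hp, n, 1, le_rfl, by simpa using hpe, by norm_num⟩

/-- `(twoSquaresPrimeSet 0).Infinite ↔ LandauConjecture`. -/
theorem twoSquaresPrimeSet_zero_infinite_iff :
    (twoSquaresPrimeSet 0).Infinite ↔ LandauConjecture := by
  rw [twoSquaresPrimeSet_zero, sqAddOnePrimeSet_infinite_iff]

/-- At `θ = 1` the square-part set is the set of primes `n² + 1`: a cofactor `a ≤ p⁰ = 1` with
`p = a d² + 1` prime is `a = 1`. -/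
theorem squarePartPrimeSet_one : squarePartPrimeSet 1 = sqAddOnePrimeSet := by
  ext p
  simp only [squarePartPrimeSet, sqAddOnePrimeSet, Set.mem_setOf_eq, sub_self, Real.rpow_zero]
  constructor
  · rintro ⟨hp, a, d, hd, hpe, hle⟩
    have ha1 : a ≤ 1 := by exact_mod_cast hle
    have ha0 : a ≠ 0 := by
      rintro rfl
      rw [zero_mul, zero_add] at hpe
      exact Nat.not_prime_one (hpe ▸ hp)
    have : a = 1 := by omega
    subst this
    exact ⟨hp, d, by simpa using hpe⟩
  · rintro ⟨hp, n, hpe⟩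
    refine ⟨hp, 1, n, ?_, by simpa using hpe, by norm_num⟩
    rcases Nat.eq_zero_or_pos n with rfl | hn
    · exact absurd (hpe ▸ hp) (by norm_num)
    · exact hn

/-- `(squarePartPrimeSet 1).Infinite ↔ LandauConjecture`. -/
theorem squarePartPrimeSet_one_infinite_iff :
    (squarePartPrimeSet 1).Infinite ↔ LandauConjecture := by
  rw [squarePartPrimeSet_one, sqAddOnePrimeSet_infinite_iff]

/-- The trivial base rung of the gpf ladder: every `n² + 1` with `n ≥ 1` has a prime factor
`> n⁰ = 1`, so `gpfSet 0 ⊇ {n | 1 ≤ n}` is infinite.  (The first non-trivial rung, the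
infinitude of `gpfSet 1`, is Chebyshev–Markov; not formalised.) -/
theorem gpfSet_zero_infinite : (gpfSet 0).Infinite := by
  have hsub : {n : ℕ | 1 ≤ n} ⊆ gpfSet 0 := by
    intro n hn
    simp only [Set.mem_setOf_eq] at hn
    have hne : n ^ 2 + 1 ≠ 1 := by
      have : 1 ≤ n ^ 2 := Nat.one_le_pow _ _ hn
      omega
    refine ⟨(n ^ 2 + 1).minFac, Nat.minFac_prime hne, Nat.minFac_dvd _, ?_⟩
    rw [Real.rpow_zero]
    exact_mod_cast (Nat.minFac_prime hne).one_lt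
  refine Set.Infinite.mono hsub (Set.infinite_of_not_bddAbove ?_)
  rintro ⟨B, hB⟩
  have := hB (show B + 1 ∈ {n : ℕ | 1 ≤ n} by simp)
  omega

/-- Summary: the four summit values coincide (and equal Landau's conjecture). -/
theorem ladder_endpoints_agree :
    ((gpfSet 2).Infinite ↔ (almostPrimeSet 1).Infinite) ∧
      ((almostPrimeSet 1).Infinite ↔ (twoSquaresPrimeSet 0).Infinite) ∧
      ((twoSquaresPrimeSet 0).Infinite ↔ (squarePartPrimeSet 1).Infinite) := by
  rw [gpfSet_two_infinite_iff, almostPrimeSet_one_infinite_iff,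
    twoSquaresPrimeSet_zero_infinite_iff, squarePartPrimeSet_one_infinite_iff]
  exact ⟨Iff.rfl, Iff.rfl, Iff.rfl⟩

/-- Hardy–Littlewood E (hence Bateman–Horn) sits above every ladder's summit. -/
theorem gpfSet_two_infinite_of_hardyLittlewoodConjE (h : HardyLittlewoodConjE) :
    (gpfSet 2).Infinite :=
  gpfSet_two_infinite_iff.2 h.landauConjecture

end Summit.Parity.BatemanHorn.Theorems
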